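import Summits.BirchSwinnertonDyer.Rank1Residual.O5.HeegnerLogTransportThreeOrdCompanion
import Summits.BirchSwinnertonDyer.Rank1Residual.O5.NoLocalThreeTorsionTransport
import Summits.BirchSwinnertonDyer.Rank1Residual.X11b.HeegnerPointScaling
import Literature.NumberTheory.EllipticCurves.HeegnerPointFiniteIndex
import HarnessLib
import HarnessLib.Audit.Tags

/-!
# Heegner-log transport at `p = 3` (KL3), part 5: KL3-C♭ on good-ordinary companions is a theorem modulo KL3-A/B/M and the
# companion-side Poitou–Tate count KL3-G (JSW17 Prop. 3.2.1 at a good `p = 3`) — o5-r2 GEN 18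

HONEST FRAMING (cell `b2b-bsdres`, run/shared/lean/b2b/bsd-rank1-residual/, verbatim in every file): the
goal of the cell is to DELETE the COMBINATION-SHAPED residual classes of the Birch–Swinnerton-Dyer formula
for ALL analytic-rank `≤ 1` elliptic curves over `ℚ` — "full BSD formula for every rank `≤ 1` curve in
class `C`" assembled STRICTLY from published theorems — so that the rank-`≤ 1` remainder becomes exactly
the CONSTRUCTION-SHAPED classes, which are TYPED (missing-input `Prop`s), NOT attempted. This is not
"finishing BSD". Team O5 (tame potentially supersingular additive `p = 3`, (t′)), planner o5-r2 (the
non-Iwasawa side), GEN 18; RESEARCH ROUTE; one THEOREM-CANDIDATE node (`GoodBaseSelmerCountThree`, a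
`def … : Prop` whose content is in print, consumed as a HYPOTHESIS, never a named fact) and THEOREMS
(bookkeeping over explicit hypotheses); no Literature fact, no `@[conjecture]` node, no new object;
NOTHING is booked and no mark of `RESIDUAL-MAP.md` moves. O5 OPEN.

## What this file records (GEN 17 docket (c′), ask A-KL3-ORD)

GEN 17 (parts 4/4b, `O5/HeegnerLogTransportThreeOrdCompanion{,Index}.lean`) reduced KL3-C♭
(`O5HeegnerUnitIndexFromCompanionThree`, `…Targets.lean` §4b) on good ORDINARY companions in row C16 to
KL3-A + per-pair NUMERICS (the two analytic `Ш`-orders of the companion pair are `3`-units and the companion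
has a `3`-primitive point `Q`). This file replaces the per-pair numerics by CLASS-LEVEL inputs:

* §0 pure algebra and Galois descent: `G(K)[3] = 0` for a mod-3 companion `G` of `W` from `W(K)[3] = 0`
  (`nsmul_eq_zero_imp_eq_zero_of_isCongruentModThree`, via the tree's equivariant `W[3] ≃+ G[3]` and
  `exists_kerEquiv_baseChange_of_equivariant`); in a group without `q`-torsion a point of infinite order and
  finite index is a `q^{ord_q index}`-th multiple (`exists_eq_pow_nsmul_of_padicValNat_index`).
* §1 W-side L1′ `padicLogOrd_eq_padicValNat_index_of_logUnit` (PROVED): at the ADDITIVE prime, `W(K)[3] = 0`,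
  `3 ∤ c₃`, and ONE point `Q ∈ W(K)` of infinite order with `ord₃ log_ω Q = 0` give, for every `P` of finite
  index, `ord₃ log_ω P = ord₃ [W(K) : ℤP]` — the `hlog` input of KL3-B's consumer
  `selmerAcBase_card_eq_one_of_units`. (X11b's line `Ψ`; no structure theorem for `W(K)` is used.)
* §2 companion side at a GOOD `3`: the integrality `ord₃ [G(K):ℤP′] ≤ ord₃ log_ω P′ + ord₃ #G̃(𝔽₃) − 1`
  (PROVED, `padicValNat_index_le_klLog`); the node KL3-G `GoodBaseSelmerCountThree` = Jetchev–Skinner–Wan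
  2017 Prop. 3.2.1 with (7.1.5) for an elliptic curve at a GOOD prime `p = 3` split in `K`
  (`#Sel_𝔭(K, G[3^∞]) = #Ш(G/K)[3^∞] · (#ℤ₃/((1 − a₃ + 3)/3 · log_ω P′))² / [G(K):ℤP′]₃²`, the `H⁰(K_v, G[3^∞])`
  factor removed by `NoLocalThreeTorsionAt G 3`, `G(K)[3] = 0` making `[·]₃ = 3^{ord₃ index}`); and the
  direction the chain consumes, PROVED: `Sel_𝔭(K, G[3^∞]) = 0 ⇒ Ш(G/K)[3^∞] = 0 ∧ ord₃((#G̃/3) log_ω P′) =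
  ord₃ [G(K):ℤP′]` (`sha_trivial_and_klLog_eq_of_selmer_trivial`).
* §3 END `o5_index_unit_of_good_companion_selmer`: for `W` (t′) with surj(3), `W(ℚ₃)[3] = 0`, clean bad
  primes, `Ш(W/K)[3^∞] = 0`, Tamagawa/Manin `3`-units, a log-unit point `Q ∈ W(K)`, and a mod-3 companion `G`
  GOOD at `3` whose pair `(G, G^{(d_K)})` satisfies the `3`-part of BSD in Miller's currency: KL3-A + KL3-B +
  KL3-M + KL3-G ⇒ `3 ∤ [W(K) : ℤP]`. Chain: L1′ ⇒ KL3-B gives `Sel_𝔭(K, W[3^∞]) = 0` ⇒ KL3-M gives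
  `Sel_𝔭(K, G[3^∞]) = 0` ⇒ §2 gives `Ш(G/K)[3^∞] = 0` and the log/index identity for `P′` ⇒ BSD₃ of the pair
  (GEN 17 §2) gives `3 ∤ [G(K):ℤP′]` ⇒ the companion Heegner log is a `3`-adic unit ⇒ KL3-A (GEN 16 W-side
  chain). `o5_index_unit_of_goodOrd_companion_selmer` plugs row C16 (Yan–Zhu 2026 Thm. 4.15, `hYZ`; Wuthrich
  Lemma 20; modularity; GZK) for BSD₃ of the pair. NET: on good-ORDINARY companions KL3-C♭ (read at
  `ι₃ = embAt 𝔭`) needs NO per-pair numerics and NO open conjecture — its non-print inputs are the three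
  Galois-cohomology theorem-candidates KL3-B, KL3-M, KL3-G (KL3-G in print). Supersingular companions: the
  BSD₃ step is row-less at `p = 3` (KL3-D open), unchanged.

References: D. Jetchev, C. Skinner, X. Wan, Camb. J. Math. 5 (2017), Prop. 3.2.1, §7.1 (7.1.5)
(arXiv:1512.06894 pp. 10–11, 15–16) [JetchevSkinnerWan2017]; D. Kriz, C. Li, Forum Math. Sigma 7 (2019)
Thm. 1.16 [KrizLi2019]; F. Castella, Math. Ann. 370 (2018) Def. 2.2, Thm. 2.3 [Castella2018]; B. H. Gross,
LMS LN 153 (1991) Conj. 1.2, §2 [GrossLMS1991]; X. Yan, X. Zhu, J. Algebra 693 (2026) Thm. 4.15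
[YanZhu2024MainConjNonCM]; J. H. Silverman, AEC VIII §1 [SilvermanAEC2009]; HOME/b2b-bsdres-o5-r2/gen18/O5-GEN18.md.

## TYPER PLACEMENT NOTE (cc-typer-5 GEN 18 = O5 §3.5 / O6 §3.4 typer of record; by-name ask A-O5-G18-1 of o5-r2 GEN 18, HOME/INBOX.md l.13673:
'place by sha, the same way as A-O5-G17-1 … as TWO tree files for lint.size, pre-split by me')

Source: `HOME/b2b-bsdres-o5-r2/gen18/lean/HeegnerLogTransportThreeOrdSelmer.lean` sha16 `94876e55775e7a08` (468 l.; `gen18/SHA16.txt`; o5-r2's `lean check` rc 0 / 0 sorries /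
0 warnings 23:42Z) PRE-SPLIT by the planner into part A `gen18/lean/split/O5_HeegnerLogTransportThreeOrdSelmer.partA.lean` `5e6912d1af4b7cb4` (316 l. = source l.1–313
+ `end`s) and part B `gen18/lean/split/O5_HeegnerLogTransportThreeOrdSelmerIndex.partB.lean` `f039c95cc56d82ab` (202 l. = source §3 l.314–468 under its own header);
THIS file = part A VERBATIM + this paragraph (the typer re-hashed all three files and asserted part A == source prefix, part B §3.. == source §3..
byte for byte, script `class-closure/typer-5/gen18/g18_place.py`; farm: part A standalone and A+B joint rc 0 / 0 warnings, axioms of the END theorems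
{propext, Classical.choice, Quot.sound}; DEDUP `lean search --decl` on the nine new names: no match).  CONTENT LABELS (source, unchanged): ONE new node
`GoodBaseSelmerCountThree` = KL3-G (Jetchev–Skinner–Wan 2017 Prop. 3.2.1 with (7.1.5), IN PRINT; typed as a plain `def … : Prop` THEOREM-CANDIDATE consumed
only as the hypothesis `hG`, exactly like KL3-A / KL3-B / KL3-M of `O5/HeegnerLogTransportThree.lean` p340741 — NOT a Literature fact, NOT `@[conjecture]`;
the advisory audit classes it `vendored-fact (untagged def : Prop)` as it does KL3-A/B/M) + 8 THEOREMS PROVED; 0 `@[conjecture]`; 0 Literature facts (net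
named-fact debt 0); no `sorry`.  Parts 1–4 of the KL3 files: `O5/HeegnerLogTransportThree{,Chain,Targets,Global}.lean` (p340741 / p341262 / p341640 / p342632),
`O5/HeegnerLogTransportThreeOrdCompanion{,Index}.lean` (p343587 / p344465), `Literature/NumberTheory/EllipticCurves/HeegnerPointFiniteIndex.lean` (p344022).
HONEST FRAMING (cell `b2b-bsdres`): research route, lane CLASS-CLOSURE §3.5 O5; nothing asserted beyond the displayed binders, nothing booked, no mark of
`RESIDUAL-MAP.md` moves; census = EVIDENCE, never a Literature fact; O5 OPEN.
-/

noncomputable section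

open scoped Classical

open WeierstrassCurve Literature.NumberTheory.EllipticCurves
  Literature.NumberTheory.EllipticCurves.ModularForms
  Literature.NumberTheory.EllipticCurves.Rank1Residual
  Literature.NumberTheory.EllipticCurves.Rank1Residual.Typed

namespace Summit.BirchSwinnertonDyer.Rank1Residual.O5.HeegnerLogTransport

open Summit.BirchSwinnertonDyer.Rank1Residual.X11b (padicLogOrd embAt padicPointOf index_zmultiples_zsmul)
open Summit.BirchSwinnertonDyer.Rank1Residual.X11b.LocalIndex (psi
  exists_addEquiv_valuation_psi_padicPointOf valuation_psi_zsmul_add)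
open Literature.NumberTheory.EllipticCurves.Rank1Residual (Addv)
open Summit.BirchSwinnertonDyer.Rank1Residual.Additive.LocalLog (reductionPointCount_of_addv)
open Summit.BirchSwinnertonDyer.Rank1Residual.X11b.AcSelmer (selmerAcBase)
open IsDedekindDomain (HeightOneSpectrum)
open scoped NumberField

/-! ## §0 Pure algebra and Galois descent -/

/-- `k • x` of infinite order forces `x` of infinite order. [folklore] -/
theorem not_isOfFinAddOrder_of_nsmul {A : Type*} [AddCommGroup A] {x : A} {k : ℕ}
    (h : ¬ IsOfFinAddOrder (k • x)) : ¬ IsOfFinAddOrder x :=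
  fun hx => h hx.nsmul

/-- **Divisibility from the index.** In an abelian group without `q`-torsion, a point `P` of infinite order
with `[A : ℤP]` finite is a `q^a`-th multiple of a point of infinite order, `a = ord_q [A : ℤP]` (induction on
`a`: `q ∣ [A : ℤP]` makes `P` a `q`-th multiple by Cauchy in `A/ℤP` — tree
`padicValNat_index_zmultiples_eq_zero` — and `[A : ℤ(q•P₁)] = q [A : ℤP₁]`). [folklore] -/
theorem exists_eq_pow_nsmul_of_padicValNat_index {A : Type*} [AddCommGroup A] {q : ℕ} [hq : Fact q.Prime]
    (hA : ∀ R : A, q • R = 0 → R = 0) :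
    ∀ (a : ℕ) (P : A), ¬ IsOfFinAddOrder P → (AddSubgroup.zmultiples P).index ≠ 0 →
      padicValNat q (AddSubgroup.zmultiples P).index = a →
      ∃ R : A, ¬ IsOfFinAddOrder R ∧ P = q ^ a • R := by
  intro a
  induction a with
  | zero =>
    intro P hP _ _
    exact ⟨P, hP, by rw [pow_zero, one_nsmul]⟩
  | succ a ih =>
    intro P hP hI ha
    have hdiv : ∃ P₁ : A, q • P₁ = P := by
      by_contra h
      push Not at h
      have h0 := padicValNat_index_zmultiples_eq_zero hA h
      omega
    obtain ⟨P₁, rfl⟩ := hdiv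
    have hP₁ : ¬ IsOfFinAddOrder P₁ := not_isOfFinAddOrder_of_nsmul hP
    have hidx : (AddSubgroup.zmultiples (q • P₁)).index = q * (AddSubgroup.zmultiples P₁).index := by
      have h := index_zmultiples_zsmul hP₁ (q : ℤ)
      rwa [natCast_zsmul, Int.natAbs_natCast] at h
    rw [hidx] at hI ha
    have hI₁ : (AddSubgroup.zmultiples P₁).index ≠ 0 := fun h => hI (by rw [h, mul_zero])
    rw [padicValNat.mul hq.out.ne_zero hI₁, padicValNat_self] at ha
    obtain ⟨R, hR, hR'⟩ := ih P₁ hP₁ hI₁ (by omega)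
    exact ⟨R, hR, by rw [hR', pow_succ', mul_nsmul']⟩

/-- **`G(K)[3] = 0` for a mod-3 companion.** Along a mod-3 congruence with `W[3]` irreducible the tree gives a
`Gal(ℚ̄/ℚ)`-equivariant `W[3] ≃+ G[3]` (`exists_addEquiv_geomTorsion_of_isCongruentModThree'`, DDT Prop. 2.6)
and hence `W(F)[3] ≃+ G(F)[3]` over every `ℚ`-field `F` (`exists_kerEquiv_baseChange_of_equivariant`, Galois
descent for points); so `W(K)[3] = 0` transports to the companion. [cite: DarmonDiamondTaylor1995, Prop. 2.6 (b) (PDF p. 53)]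
[cite: SilvermanAEC2009, VIII.§1 (proof of Prop. 1.2)] -/
theorem nsmul_eq_zero_imp_eq_zero_of_isCongruentModThree (W G : WeierstrassCurve ℚ) [W.IsElliptic]
    [W.IsGloballyMinimal] [G.IsElliptic] [G.IsGloballyMinimal] (hirr : W.HasIrreducibleModPGaloisRep 3)
    (hcong : IsCongruentModThree W G) (K : Type) [Field K] [NumberField K]
    (hW : ∀ R : (W.baseChange K).toAffine.Point, 3 • R = 0 → R = 0) :
    ∀ R : (G.baseChange K).toAffine.Point, 3 • R = 0 → R = 0 := by
  intro R hR
  obtain ⟨θ, hθ⟩ := exists_addEquiv_geomTorsion_of_isCongruentModThree' W G hirr hcong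
  obtain ⟨e⟩ := exists_kerEquiv_baseChange_of_equivariant W G K (n := 3) (by norm_num) θ hθ
  by_contra hR0
  obtain ⟨a, ha0, ha⟩ :=
    (exists_ne_zero_nsmul_eq_zero_iff_of_kerEquiv (k := 3) (by norm_num) e).mpr ⟨R, hR0, hR⟩
  exact ha0 (hW a ha)

/-! ## §1 W-side L1′ (ADDITIVE prime): one log-unit point pins the log order of every point of finite index to the index -/

/-- **L1′.** For `W/ℚ` globally minimal with ADDITIVE reduction at `3` (`#W̃_ns(𝔽₃) = 3`), `3 ∤ c₃`, a number
field `K` with `W(K)[3] = 0`, an embedding `ι₃ : K →+* ℚ₃`, and `P, Q ∈ W(K)` of infinite order with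
`[W(K) : ℤP]` finite: if `ord₃ log_{ω} Q = 0` then `ord₃ log_{ω} P = ord₃ [W(K) : ℤP]`. Proof on X11b's line
`Ψ` (`v(Ψ X_ι) = ord₃ log_ω X` here, `v(Ψ(m • x)) = ord₃ m + v(Ψ x)`): `I • Q = n • P` with `I` the index;
`Q` is no `3`-rd multiple (tree L1, additive), so `[W(K) : ℤQ] = |n|` is prime to `3`; hence
`ord₃ I + 0 = ord₃ n + v(Ψ P_ι) = v(Ψ P_ι)`. The `hlog` input of `selmerAcBase_card_eq_one_of_units`.
[cite: Castella2018, proof of Thm. 2.3, (calcul) (arXiv:1704.06608 p. 6)] [cite: GrossLMS1991, §2 (sentence after (2.2))] -/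
theorem padicLogOrd_eq_padicValNat_index_of_logUnit (W : WeierstrassCurve ℚ) [W.IsElliptic]
    [W.IsGloballyMinimal] (hadd : Addv W 3) (hc : ¬ 3 ∣ (W.baseChange ℚ_[3]).localTamagawaNumber ℤ_[3])
    {K : Type} [Field K] [NumberField K]
    (htors : ∀ R : (W.baseChange K).toAffine.Point, 3 • R = 0 → R = 0) (ι₃ : K →+* ℚ_[3])
    (P Q : (W.baseChange K).toAffine.Point) (hP : ¬ IsOfFinAddOrder P) (hQ : ¬ IsOfFinAddOrder Q)
    (hI0 : (AddSubgroup.zmultiples P).index ≠ 0) (hQunit : padicLogOrd W 3 ι₃ Q = 0) :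
    padicLogOrd W 3 ι₃ P = padicValNat 3 (AddSubgroup.zmultiples P).index := by
  haveI : ((W.baseChange ℚ_[3]).formalFiltration 2).FiniteIndex :=
    (W.baseChange ℚ_[3]).finiteIndex_formalFiltration 2
  obtain ⟨φ, hφ⟩ := exists_addEquiv_valuation_psi_padicPointOf W 3 (K := K)
  have hc0 : padicValNat 3 ((W.baseChange ℚ_[3]).localTamagawaNumber ℤ_[3]) = 0 :=
    padicValNat.eq_zero_of_not_dvd hc
  have hns : padicValNat 3 (reductionPointCount W 3) = 1 := by
    rw [reductionPointCount_of_addv W 3 hadd]; simp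
  have hPι := not_isOfFinAddOrder_padicPointOf W 3 ι₃ P hP
  have hQι := not_isOfFinAddOrder_padicPointOf W 3 ι₃ Q hQ
  have eP := hφ ι₃ P hPι
  have eQ := hφ ι₃ Q hQι
  rw [hc0, hns] at eP eQ
  simp only [Nat.cast_zero, Nat.cast_one, add_zero, add_sub_cancel_right] at eP eQ
  rw [hQunit] at eQ
  have hvQ : (psi ((W.baseChange ℚ_[3]).formalFiltration 2) φ (padicPointOf W 3 ι₃ Q)).valuation = 0 := by
    exact_mod_cast eQ
  -- the index relation `I • Q = n • P`
  set I := (AddSubgroup.zmultiples P).index with hIdef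
  have hmem : I • Q ∈ AddSubgroup.zmultiples P := AddSubgroup.nsmul_index_mem _ Q
  obtain ⟨n, hn⟩ := AddSubgroup.mem_zmultiples_iff.mp hmem
  have hIQ : ¬ IsOfFinAddOrder (I • Q) := not_isOfFinAddOrder_nsmul hQ hI0
  have hn0 : n ≠ 0 := by
    rintro rfl
    rw [zero_zsmul] at hn
    exact hIQ (hn ▸ (isOfFinAddOrder_iff_nsmul_eq_zero).mpr ⟨1, one_pos, by simp⟩)
  -- `[W(K) : ℤQ] = |n|` (compare the indices of `ℤ(I • Q) = ℤ(n • P)`), hence prime to `3`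
  have hJ : (AddSubgroup.zmultiples Q).index = n.natAbs := by
    have h1 := index_zmultiples_zsmul hQ (I : ℤ)
    have h2 := index_zmultiples_zsmul hP n
    rw [natCast_zsmul, Int.natAbs_natCast, ← hn, h2] at h1
    have h3 : I * (AddSubgroup.zmultiples Q).index = I * n.natAbs := by
      rw [mul_comm I n.natAbs]; exact h1.symm
    exact Nat.eq_of_mul_eq_mul_left (Nat.pos_of_ne_zero hI0) h3
  have hvn : padicValNat 3 n.natAbs = 0 := by
    rw [← hJ]
    exact padicValNat_index_zmultiples_eq_zero htors
      (not_nsmul_eq_of_padicLogOrd_eq_zero_of_addv W 3 hadd ι₃ Q hQι hc hQunit)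
  -- read `n • P_ι = I • Q_ι` on the line `Ψ`
  have hI0' : ((I : ℕ) : ℤ) ≠ 0 := by exact_mod_cast hI0
  have ht : IsOfFinAddOrder (0 : (W.baseChange ℚ_[3]).toAffine.Point) :=
    (isOfFinAddOrder_iff_nsmul_eq_zero).mpr ⟨1, one_pos, by simp⟩
  have h1 := valuation_psi_zsmul_add ((W.baseChange ℚ_[3]).formalFiltration 2) φ hPι ht hn0
  have h2 := valuation_psi_zsmul_add ((W.baseChange ℚ_[3]).formalFiltration 2) φ hQι ht hI0'
  have hmap : n • padicPointOf W 3 ι₃ P + 0 = ((I : ℕ) : ℤ) • padicPointOf W 3 ι₃ Q + 0 := by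
    rw [add_zero, add_zero, natCast_zsmul]
    unfold padicPointOf
    rw [← map_zsmul, ← map_nsmul, hn]
  rw [hmap, h2, Int.natAbs_natCast, hvQ, add_zero, hvn, zero_add] at h1
  rw [← eP, ← h1]

/-! ## §2 Companion side at a GOOD `3`: integrality, the Poitou–Tate count KL3-G, and the direction the chain consumes -/

/-- **Integrality of the KL-normalised logarithm against the index** at a GOOD prime `3`: for `G(K)[3] = 0` and
`P` of infinite order and finite index, `ord₃ [G(K) : ℤP] ≤ ord₃ log_{ω_G} P + ord₃ #G̃(𝔽₃) − 1` (the right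
side is `v(Ψ P_ι)`, `c₃ = 1`; `P = 3^a • R` by §0, and `v(Ψ(3^a • R_ι)) = a + v(Ψ R_ι) ≥ a`). JSW's `#δ_v ≥ 1`.
[cite: JetchevSkinnerWan2017, §7.1 (7.1.5) (arXiv:1512.06894 p. 16)] [cite: Castella2018, proof of Thm. 2.3, (calcul)] -/
theorem padicValNat_index_le_klLog (G : WeierstrassCurve ℚ) [G.IsElliptic] [G.IsGloballyMinimal]
    (hgood : G.HasGoodReductionAtPrime 3) {K : Type} [Field K] [NumberField K]
    (htors : ∀ R : (G.baseChange K).toAffine.Point, 3 • R = 0 → R = 0) (ι₃ : K →+* ℚ_[3])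
    (P : (G.baseChange K).toAffine.Point) (hP : ¬ IsOfFinAddOrder P)
    (hI0 : (AddSubgroup.zmultiples P).index ≠ 0) :
    (padicValNat 3 (AddSubgroup.zmultiples P).index : ℤ) ≤
      padicLogOrd G 3 ι₃ P + padicValInt 3 (nsCount G 3) - 1 := by
  haveI : ((G.baseChange ℚ_[3]).formalFiltration 2).FiniteIndex :=
    (G.baseChange ℚ_[3]).finiteIndex_formalFiltration 2
  obtain ⟨φ, hφ⟩ := exists_addEquiv_valuation_psi_padicPointOf G 3 (K := K)
  have hc : (G.baseChange ℚ_[3]).localTamagawaNumber ℤ_[3] = 1 :=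
    localTamagawaNumber_padic_eq_one_of_good_holds G 3 hgood
  have hns : ((padicValNat 3 (reductionPointCount G 3) : ℕ) : ℤ) = padicValInt 3 (nsCount G 3) := by
    rw [nsCount_eq_reductionPointCount_of_good G 3 hgood, padicValInt.of_nat]
  set a := padicValNat 3 (AddSubgroup.zmultiples P).index with ha
  obtain ⟨R, hR, hPR⟩ := exists_eq_pow_nsmul_of_padicValNat_index htors a P hP hI0 ha.symm
  have hRι := not_isOfFinAddOrder_padicPointOf G 3 ι₃ R hR
  have hPι := not_isOfFinAddOrder_padicPointOf G 3 ι₃ P hP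
  have eP := hφ ι₃ P hPι
  rw [hc] at eP
  simp only [padicValNat_one_right, CharP.cast_eq_zero, add_zero] at eP
  rw [hns] at eP
  rw [← eP]
  have ht : IsOfFinAddOrder (0 : (G.baseChange ℚ_[3]).toAffine.Point) :=
    (isOfFinAddOrder_iff_nsmul_eq_zero).mpr ⟨1, one_pos, by simp⟩
  have h3a : ((3 ^ a : ℕ) : ℤ) ≠ 0 := by positivity
  have h1 := valuation_psi_zsmul_add ((G.baseChange ℚ_[3]).formalFiltration 2) φ hRι ht h3a
  have hmap : ((3 ^ a : ℕ) : ℤ) • padicPointOf G 3 ι₃ R + 0 = padicPointOf G 3 ι₃ P := by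
    rw [add_zero, natCast_zsmul]
    conv_rhs => rw [hPR]
    unfold padicPointOf
    rw [map_nsmul]
  rw [hmap, Int.natAbs_natCast, padicValNat.prime_pow] at h1
  rw [h1]
  push_cast
  omega

/-- **KL3-G `GoodBaseSelmerCountThree` (THEOREM-CANDIDATE = Jetchev–Skinner–Wan 2017 Prop. 3.2.1 with §7.1
(7.1.5) for an elliptic curve at a GOOD prime `p = 3`; in print; consumed as a hypothesis, never a named
fact).** For `G/ℚ` globally minimal with GOOD reduction at `3` and `G(ℚ₃)[3] = 0` (`NoLocalThreeTorsionAt`, so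
`H⁰(K_v, G[3^∞]) = 0`), an imaginary quadratic `K` with `G(K)[3] = 0`, `rank_ℤ G(K) = 1` and `Ш(G/K)` finite
(JSW (corank 1) + (sur), §7.1), a point `P ∈ G(K)` of infinite order, and a degree-one prime `𝔭 ∣ 3` of `K`
(so `3` splits, `v = 𝔭`): Castella's base Selmer group `Sel_𝔭(K, G[3^∞])` (strict at `𝔭`, relaxed at `𝔭̄`,
trivial away from `3`; `X11b.AcSelmer.selmerAcBase`, the object of KL3-B/KL3-M) is finite of order `3^a`,
`a = ord₃ #Ш(G/K)[3^∞] + 2·(ord₃((1 − a₃ + 3)/3 · log_{ω_G} P) − ord₃ [G(K) : ℤP])`, the logarithm read along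
`K ↪ K_𝔭 = ℚ₃` (`embAt`); `1 − a₃ + 3 = #G̃(𝔽₃) = nsCount G 3`. Ordinary OR supersingular. The companion-side
twin of KL3-B (whose additive-3 local term differs). [cite: JetchevSkinnerWan2017, Prop. 3.2.1 and (7.1.5) (arXiv:1512.06894 pp. 10–11, 15–16)]
[cite: Castella2018, Def. 2.2 (arXiv:1704.06608 p. 5)] -/
def GoodBaseSelmerCountThree : Prop :=
  ∀ (G : WeierstrassCurve ℚ) [G.IsElliptic] [G.IsGloballyMinimal],
    G.HasGoodReductionAtPrime 3 → NoLocalThreeTorsionAt G 3 →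
    ∀ (K : Type) [Field K] [NumberField K], IsImaginaryQuadratic K →
      (∀ R : (G.baseChange K).toAffine.Point, 3 • R = 0 → R = 0) →
      (G.baseChange K).mordellWeilRank = 1 → (G.baseChange K).ShaFinite →
      ∀ (P : (G.baseChange K).toAffine.Point), ¬ IsOfFinAddOrder P →
        ∀ (𝔭 : HeightOneSpectrum (𝓞 K)) (h𝔭 : ((3 : ℕ) : 𝓞 K) ∈ 𝔭.asIdeal)
          (he : 𝔭.asIdeal.ramificationIdx (𝓞 ℚ) = 1) (hf : 𝔭.asIdeal.inertiaDeg (𝓞 ℚ) = 1),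
          ∃ a : ℕ, (∃ _ : Finite (selmerAcBase (G.baseChange K) 3 𝔭 ∅),
              Nat.card (selmerAcBase (G.baseChange K) 3 𝔭 ∅) = 3 ^ a) ∧
            (a : ℤ) = (padicValNat 3 (Nat.card (AddCommGroup.primaryComponent (G.baseChange K).sha 3)) : ℤ) +
              2 * (padicLogOrd G 3 (embAt K 3 𝔭 h𝔭 he hf) P + padicValInt 3 (nsCount G 3) - 1 -
                (padicValNat 3 (AddSubgroup.zmultiples P).index : ℤ))

/-- **The direction the chain consumes, PROVED**: under KL3-G, `Sel_𝔭(K, G[3^∞]) = 0` forces `Ш(G/K)[3^∞] = 0`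
AND `ord₃((#G̃(𝔽₃)/3)·log_{ω_G} P) = ord₃ [G(K) : ℤP]` (both summands of `a = 0` are `≥ 0`, the second by
`padicValNat_index_le_klLog`). [cite: JetchevSkinnerWan2017, Prop. 3.2.1 and (7.1.5) (arXiv:1512.06894 pp. 10–11, 16)] -/
theorem sha_trivial_and_klLog_eq_of_selmer_trivial (hG : GoodBaseSelmerCountThree)
    (G : WeierstrassCurve ℚ) [G.IsElliptic] [G.IsGloballyMinimal] (hgood : G.HasGoodReductionAtPrime 3)
    (ht : NoLocalThreeTorsionAt G 3) (K : Type) [Field K] [NumberField K] (hK : IsImaginaryQuadratic K)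
    (htors : ∀ R : (G.baseChange K).toAffine.Point, 3 • R = 0 → R = 0)
    (hrank : (G.baseChange K).mordellWeilRank = 1) (hfin : (G.baseChange K).ShaFinite)
    (P : (G.baseChange K).toAffine.Point) (hP : ¬ IsOfFinAddOrder P)
    (hI0 : (AddSubgroup.zmultiples P).index ≠ 0)
    (𝔭 : HeightOneSpectrum (𝓞 K)) (h𝔭 : ((3 : ℕ) : 𝓞 K) ∈ 𝔭.asIdeal)
    (he : 𝔭.asIdeal.ramificationIdx (𝓞 ℚ) = 1) (hf : 𝔭.asIdeal.inertiaDeg (𝓞 ℚ) = 1)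
    (hSel : Nat.card (selmerAcBase (G.baseChange K) 3 𝔭 ∅) = 1) :
    Nat.card (AddCommGroup.primaryComponent (G.baseChange K).sha 3) = 1 ∧
      padicLogOrd G 3 (embAt K 3 𝔭 h𝔭 he hf) P + padicValInt 3 (nsCount G 3) - 1 =
        (padicValNat 3 (AddSubgroup.zmultiples P).index : ℤ) := by
  obtain ⟨a, ⟨_, hcard⟩, ha⟩ := hG G hgood ht K hK htors hrank hfin P hP 𝔭 h𝔭 he hf
  rw [hSel] at hcard
  have ha0 : a = 0 := by
    by_contra h0
    have h3 : 3 ≤ 3 ^ a := by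
      calc (3 : ℕ) = 3 ^ 1 := (pow_one 3).symm
        _ ≤ 3 ^ a := Nat.pow_le_pow_right (by norm_num) (Nat.pos_of_ne_zero h0)
    omega
  subst ha0
  have hle := padicValNat_index_le_klLog G hgood htors (embAt K 3 𝔭 h𝔭 he hf) P hP hI0
  simp only [CharP.cast_eq_zero] at ha
  have hsha0 : padicValNat 3 (Nat.card (AddCommGroup.primaryComponent (G.baseChange K).sha 3)) = 0 := by
    omega
  refine ⟨?_, by omega⟩
  haveI : (G.baseChange K).IsElliptic := by rw [WeierstrassCurve.baseChange]; infer_instance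
  haveI : Finite (G.baseChange K).sha := hfin
  haveI : Finite (AddCommGroup.primaryComponent (G.baseChange K).sha 3) :=
    Finite.of_injective _ Subtype.val_injective
  obtain ⟨n, hn⟩ := exists_card_addPrimaryComponent_eq_pow (A := (G.baseChange K).sha) 3
  rw [hn, padicValNat.prime_pow] at hsha0
  rw [hn, hsha0, pow_zero]

end Summit.BirchSwinnertonDyer.Rank1Residual.O5.HeegnerLogTransport

end
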